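import Summits.ResolutionOfSingularities.ResolutionOfSingularities.Theorems.EquisingularLiftEquisingularLiftNatNDInvariants
import HarnessLib

/-!
# [OURS · L1 W4.5(b) · EL♮(3)] PORT DRAFT for lead-2's k-side successor file (desk RULING 2026-08-28T14:08:16Z «RE-DEAL k-SIDE»): the (B4α′) SPLIT —
# `Aff`, `affOrigin`, `isClosed_affOrigin`, `coordHyperplane`, `ModelRound` (B4α as a Prop), `TransportRound` (B4β as a Prop) and the PROVED composition
# `roundAtNDFrame_of_model : (∀ g, LocalNDWon g → ModelRound n k g) → TransportRound n k → RoundAtNDFrame n k`, VERBATIM from SPEC v8 §13.13 of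
# `Cruxes/EquisingularLiftNatThree/NewtonNondegenerateRungK5.lean`

OURS · counted 0 · AI-written (res-L1-w45b-idea-1 g23), weaker than expert review; nothing of [Hironaka2017] asserted; no statement of the manuscript.
Definitions + PROVED pure logic only (no `sorry`, no instance, no notation). Namespace `…Cruxes.EquisingularLiftNat.Sections.ND`.
Bricks close BY NAME against the ported decls: (B4α) `modelRound (g) (hg : LocalNDWon g) : ModelRound n k g` (stub-4), (B4β) `transportRound [IsAlgClosed k] :
TransportRound n k` (027; backup stub-2); then `roundAtNDFrame n k := roundAtNDFrame_of_model n k (modelRound n k) (transportRound n k)`.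
-/

set_option linter.dupNamespace false

noncomputable section

open CategoryTheory CategoryTheory.Limits AlgebraicGeometry TopologicalSpace Topology
open Literature.AlgebraicGeometry.Resolution
open AlgebraicGeometry.Scheme.IdealSheafData

namespace Summit.ResolutionOfSingularities.ResolutionOfSingularities.Cruxes.EquisingularLiftNat.Sections.ND

section RoundModel

variable (n : ℕ) (k : Type) [Field k]

/-- Affine `n`-space `𝔸ⁿ_k = Spec k[X₁, …, Xₙ]`. [OURS · model object] -/
abbrev Aff : AlgebraicGeometry.Scheme.{0} := AlgebraicGeometry.Spec (.of (MvPolynomial (Fin n) k))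

/-- The origin of `𝔸ⁿ_k` (the maximal ideal `(X₁, …, Xₙ) = ker constantCoeff`). [OURS · model object] -/
def affOrigin : (Aff n k : AlgebraicGeometry.Scheme.{0}) := ⟨Literature.AlgebraicGeometry.Resolution.originIdeal k n, inferInstance⟩

/-- The origin is a closed point. [OURS · small print, PROVED] -/
theorem isClosed_affOrigin : IsClosed ({affOrigin n k} : Set (Aff n k)) :=
  (PrimeSpectrum.isClosed_singleton_iff_isMaximal _).mpr (Literature.AlgebraicGeometry.Resolution.originIdeal.isMaximal k n)

/-- The coordinate frame of `𝔸ⁿ_k`: `coordHyperplane i` = the reduced ideal sheaf of the closed set `V(Xᵢ)`. [OURS · model object] -/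
def coordHyperplane (i : Fin n) : (Aff n k).IdealSheafData :=
  AlgebraicGeometry.Scheme.IdealSheafData.vanishingIdeal
    (⟨PrimeSpectrum.zeroLocus {(MvPolynomial.X i : MvPolynomial (Fin n) k)}, PrimeSpectrum.isClosed_zeroLocus _⟩ : TopologicalSpace.Closeds (Aff n k))

/-- **`ModelRound n k g`** — the conclusion of `RoundAtNDFrame` at the MODEL `(𝔸ⁿ_k, origin, coordinate frame, V(g))`. [OURS · L1 W4.5b · statement (Prop)] -/
def ModelRound (g : MvPolynomial (Fin n) k) : Prop :=
  ∀ (A₂ : AlgebraicGeometry.Scheme.{0}) (π₀ : A₂ ⟶ Aff n k),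
    Literature.AlgebraicGeometry.Resolution.IsBlowup π₀
      (AlgebraicGeometry.Scheme.IdealSheafData.vanishingIdeal (⟨{affOrigin n k}, isClosed_affOrigin n k⟩ : TopologicalSpace.Closeds (Aff n k))) →
    ∃ (F₉ : AlgebraicGeometry.Scheme.{0}) (β : F₉ ⟶ A₂) (T₉ : Set F₉),
      StrataTower A₂ ((frameBoundary (coordHyperplane n k)).stepAlong
          (AlgebraicGeometry.Scheme.IdealSheafData.vanishingIdeal (⟨{affOrigin n k}, isClosed_affOrigin n k⟩ : TopologicalSpace.Closeds (Aff n k))) 1 π₀)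
        (closure (π₀ ⁻¹' (PrimeSpectrum.zeroLocus {g} \ {affOrigin n k}))) F₉ β T₉ ∧
      Literature.AlgebraicGeometry.Resolution.Scheme.IsRegular F₉ ∧ IsClosed T₉ ∧
      (∀ z : ↥(AlgebraicGeometry.Scheme.IdealSheafData.vanishingIdeal (⟨closure T₉, isClosed_closure⟩ : TopologicalSpace.Closeds F₉)).subscheme, ((AlgebraicGeometry.Scheme.IdealSheafData.vanishingIdeal (⟨closure T₉, isClosed_closure⟩ : TopologicalSpace.Closeds F₉)).subschemeι z : F₉) ∈ (β ≫ π₀) ⁻¹' {affOrigin n k} →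
        IsRegularLocalRing ((AlgebraicGeometry.Scheme.IdealSheafData.vanishingIdeal (⟨closure T₉, isClosed_closure⟩ : TopologicalSpace.Closeds F₉)).subscheme.presheaf.stalk z)) ∧
      CategoryTheory.IsIso ((β ≫ π₀) ∣_ (⟨{affOrigin n k}ᶜ, (isClosed_affOrigin n k).isOpen_compl⟩ : (Aff n k).Opens)) ∧
      T₉ ∩ (β ≫ π₀) ⁻¹' {affOrigin n k}ᶜ = (β ≫ π₀) ⁻¹' (PrimeSpectrum.zeroLocus {g} \ {affOrigin n k})

/-- **`TransportRound n k`** — `RoundAtNDFrame` with the frame data unpacked and the MODEL ROUND of its `g` as an extra hypothesis. [OURS · L1 W4.5b · statement (Prop)] -/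
def TransportRound : Prop :=
  ∀ (F₁ : AlgebraicGeometry.Scheme.{0}) (ρ : F₁ ⟶ (Literature.AlgebraicGeometry.Motives.projectiveSpace n k).left) (T₁ : Set F₁),
    Literature.AlgebraicGeometry.Resolution.Scheme.IsRegular F₁ → IsClosed T₁ →
    ∀ (x : F₁) (hx : IsClosed ({x} : Set F₁)) (W : Fin n → F₁.IdealSheafData)
      (w : Fin n → F₁.presheaf.stalk x) (g : MvPolynomial (Fin n) k),
      (∀ j, stalkIdeal (W j) x = Ideal.span {w j}) →
      Ideal.span (Set.range w) = IsLocalRing.maximalIdeal (F₁.presheaf.stalk x) →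
      ringKrullDim (F₁.presheaf.stalk x) = (n : WithBot ℕ∞) →
      LocalNDWon g →
      stalkIdeal (AlgebraicGeometry.Scheme.IdealSheafData.vanishingIdeal (⟨closure T₁, isClosed_closure⟩ : TopologicalSpace.Closeds F₁)) x =
        Ideal.span {MvPolynomial.eval₂ (baseToStalk n k ρ x) w g} →
      ModelRound n k g →
    ∀ (F₂ : AlgebraicGeometry.Scheme.{0}) (υ : F₂ ⟶ F₁),
      Literature.AlgebraicGeometry.Resolution.IsBlowup υ
        (AlgebraicGeometry.Scheme.IdealSheafData.vanishingIdeal (⟨{x}, hx⟩ : TopologicalSpace.Closeds F₁)) →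
      ∃ (F₉ : AlgebraicGeometry.Scheme.{0}) (β : F₉ ⟶ F₂) (T₉ : Set F₉),
        StrataTower F₂ ((frameBoundary W).stepAlong
            (AlgebraicGeometry.Scheme.IdealSheafData.vanishingIdeal (⟨{x}, hx⟩ : TopologicalSpace.Closeds F₁)) 1 υ)
          (closure (υ ⁻¹' (T₁ \ {x}))) F₉ β T₉ ∧
        Literature.AlgebraicGeometry.Resolution.Scheme.IsRegular F₉ ∧ IsClosed T₉ ∧
        (∀ z : ↥(AlgebraicGeometry.Scheme.IdealSheafData.vanishingIdeal (⟨closure T₉, isClosed_closure⟩ : TopologicalSpace.Closeds F₉)).subscheme, ((AlgebraicGeometry.Scheme.IdealSheafData.vanishingIdeal (⟨closure T₉, isClosed_closure⟩ : TopologicalSpace.Closeds F₉)).subschemeι z : F₉) ∈ (β ≫ υ) ⁻¹' {x} →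
          IsRegularLocalRing ((AlgebraicGeometry.Scheme.IdealSheafData.vanishingIdeal (⟨closure T₉, isClosed_closure⟩ : TopologicalSpace.Closeds F₉)).subscheme.presheaf.stalk z)) ∧
        CategoryTheory.IsIso ((β ≫ υ) ∣_ (⟨{x}ᶜ, hx.isOpen_compl⟩ : F₁.Opens)) ∧
        T₉ ∩ (β ≫ υ) ⁻¹' {x}ᶜ = (β ≫ υ) ⁻¹' (T₁ \ {x})

/-- **THE COMPOSITION, PROVED**: (B4α) for every `g ∈ LocalNDWon` and (B4β) give (B4α′) `RoundAtNDFrame`. [OURS · pure logic] -/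
theorem roundAtNDFrame_of_model (hα : ∀ g : MvPolynomial (Fin n) k, LocalNDWon g → ModelRound n k g) (hβ : TransportRound n k) :
    RoundAtNDFrame n k := by
  intro F₁ ρ T₁ hreg hT₁ x hx W hW F₂ υ hυ
  obtain ⟨w, g, h1, h2, h3, h4, h5⟩ := hW
  exact hβ F₁ ρ T₁ hreg hT₁ x hx W w g h1 h2 h3 h4 h5 (hα g h4) F₂ υ hυ

end RoundModel

end Summit.ResolutionOfSingularities.ResolutionOfSingularities.Cruxes.EquisingularLiftNat.Sections.ND
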